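/-
Copyright (c) 2026 the pub-hodgecm-mathlib formalisation cell (harness21).  Prover seat hodgecm-mathlib-K2E4-p11 (g6), Track B ∕ K2-LIT, h413 = `stmt-HodgeConjecture-24833`,
line `K2_E1_TraceFormulaBeta`, campaign «5Res ENDGAME BY FAMILIES», ROADCARD §3′ D4′c (SD), dealer K2E1-plan (g7) deal (264): THE M1 RESIDUE PRINT — at every real `c > ½` the truncated
`χ`-Eisenstein family of a self-dual unitary `χ` of `U(1,1)_{L∕L⁺}` has an `L²`-RESIDUE `u_c`, its scattering coordinates have at most SIMPLE poles, and the residue `r_c` of the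
scattering pairing is REAL, `≥ 0`, with `‖u_c‖² ≤ cμ·K·Re r_c` — my (SD) residue chain ∘ ★ B2 ∘ the (α) family export, hypothesis-first on the M1 package clauses (the binders of ★
`chi_scattering_noComplexPole_of_model_m1_cm_two`).
-/
import Summits.HodgeConjecture.HodgeConjecture.Theorems.K2E1ChiScatteringRealPolesOfModelM1CMTwo    -- ★ p860653 (K2E1-p13): `coeFn_sum_smul_ae`; brings ★ p860605 (letter block, topology), ★ B2 `inner_truncatedFamily_eq_fourTerm_chi_model_cm_two`
import Summits.HodgeConjecture.HodgeConjecture.Theorems.K2E1ChiMaassSelbergRealPoleLettersCMTwo    -- ★ p860774 (this seat): the pole letters `hd∕hdw∕hb` on ★ p860605's letter block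
import Summits.HodgeConjecture.HodgeConjecture.Theorems.K2E1ChiMaassSelbergRealPoleCMTwo           -- ★ p860642 (this seat): χ road plumbing (upper+lower) ⟹ residue; brings ★ p860558, ★ vector-α
import Summits.HodgeConjecture.HodgeConjecture.Theorems.K2E1MaassSelbergResiduePositivity           -- ★ p860661 (this seat): fixed-T positivity `‖u‖² ≤ Cμ·CK·Re r`, `Im r = 0`
import HarnessLib

/-!
# D4′c (SD), THE M1 RESIDUE PRINT — `K2E1ChiMaassSelbergResidueM1CMTwo`: for a self-dual unitary `χ` of `U(1,1)_{L∕L⁺}` at maximal level and EVERY real `c > ½`: the scattering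
# coordinates `qc_j` have AT MOST SIMPLE POLES at `c`; the truncated family `Λ^{T₀}E(f_z^φ)` has an `L²`-RESIDUE `u_c = lim (z−c)•Fam z`; the residue `r_c` of the scattering pairing
# `κ·⟪φ_K, ψ(z)⟫` is REAL, `≥ 0`, and `‖u_c‖² ≤ cμ·K·Re r_c` — hypothesis-first on the M1 package clauses (★ OfModel binders), the families of the (α) export, `hdec′`, `hconj`

Track B ∕ K2-LIT, crux h413 = `stmt-HodgeConjecture-24833`, route of record `HCCMUnconditional`; cell `hodgecm-mathlib`, squad K2, ENGINE E1; dealer K2E1-plan (g7) (264): «the M1 RESIDUE PRINT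
= your chain ∘ K2E1-p13's Complete ⟹ at each real pole c ∈ (½,1] of qc: residue vector u_c ∈ L², Res real ≥ 0 — K2E1-p14's skeleton consumes `hRpos∕hr`».  THEOREMS ONLY (no `def`, no
`instance`, no `notation`, no named-fact hypothesis, no `sorry`; default heartbeats); lane `--supports stmt-HodgeConjecture-24833 --as helper` (count-neutral).  Closes no socket.

BINDERS = those of ★ `chi_scattering_noComplexPole_of_model_m1_cm_two` VERBATIM (structural measures; `χ` self-dual unitary trivial on `ℝ_{>0}`; the M1 section `φ`; the package clauses
`b q qc Ec P hqφ hqNF hE1 hqcq hPc hPcd hqa`; the `L²(K_U)` classes `φK bK`, `hbKli`, `hκ`; the per-ball families `U hUo hUcod T₀ hT₀ Fam hFd hFam` of the (α) export; `hdec′`; `hconj`)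
PLUS the rank-one identification `hbKφ : ∀ j, bK j = φK` of the M1 block (★ Complete: `ι′ = Unit`, `bV j = φ`) — which makes the scattering pairing `κ·⟪φK, ψ x⟫ = κ·Σ_j qc_j(x)·‖φK‖²`
REAL at real `x ∉ P` by `hconj`.  ★ `chi_scattering_real_poles_m1_complete_cm_two` supplies every clause letter-free at M1 (with `hdec′` := ★ `hdec_maximalLevel_cm_two`, `hconj` := ★ p860445);
the one-line `_complete` corollary is left to the (SD) assembler who holds those obtains (K2E1-p14 ∕ K2E1-p13), exactly as ★ LetterFree∕Complete did for `hs`.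

THE MATHEMATICS ([MoeglinWaldspurger1995, IV.1.11, IV.2.3, IV.3.12 (a)]; [Langlands1976, §7]; [BernsteinLapid2019, Thm 2.3, §4]).  Fix a real `c > ½` and the ball `n = max 2 ⌈‖c‖⌉₊`.  ★ B2
gives the self-dual model Maass–Selberg relation for `Fam n` on the WHOLE holomorphy domain `W(n) = ({½ < Re} ∩ D_n ∩ U_n) ∖ P` (both half-planes: B2's domain is a parameter), with ONE pair
of constants `cμ, K > 0`; restricted to the upper quarter-domain it is the `hrel` of ★ p860605's letter block, so ★ p860774 gives the POLE LETTERS at `c` (`(z−c)·qc_j` analytic — simple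
poles; `(z−c)·κ⟪φK, ψ z⟫ =: d` analytic; `|z−c|²·κ‖ψ z‖²` bounded); restricted to the upper AND lower quarter-domains it is the pair `hrel₁∕hrel₂` of ★ p860642, so the `L²`-RESIDUE
`u = lim_{z→c} (z−c)•Fam n z` exists and `‖Fam n z‖² = R₁(z; a, κ⟪φK,ψ z⟫, κ‖ψ z‖²)` off the axis near `c`; the pairing is real on the real axis (rank one + `hconj`), so ★ p860661 gives
`Im r = 0`, `‖u‖² ≤ cμ·K·Re r`, `0 ≤ Re r` for `r = d(c) = lim (z−c)·κ⟪φK, ψ z⟫`.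
* §1 (pure) `lowerBallDomain_topology` (the lower twin of ★ `upperBallDomain_topology`), `eventually_normSq_eq_fourTerm` (the `hdiag` equality from the two diagonal identities).
* §2 HEAD **`chi_maassSelberg_residue_m1_cm_two`**.
HONEST LABEL: HC_CM is proved only modulo the 7 printed citations (2 remaining named inputs: hLiu418 = `stmt-HodgeConjecture-24832`, h413 = `stmt-HodgeConjecture-24833`) until rung 0
closes; this file asserts no named fact, is conditional by construction on its visible binders (all with ★ payers at M1), and closes no socket.

## References
* [MoeglinWaldspurger1995] C. Mœglin, J.-L. Waldspurger, *Spectral decomposition and Eisenstein series* (1995), IV.1.11, IV.2.3, IV.3.12 (a).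
* [Langlands1976] R. P. Langlands, *On the Functional Equations Satisfied by Eisenstein Series*, LNM 544 (1976), §7.
* [BernsteinLapid2019] J. Bernstein, E. Lapid, *On the meromorphic continuation of Eisenstein series*, J. AMS 37 (2024), Thm 2.3, §4.
-/

set_option autoImplicit false
-- the mandated namespace repeats `HodgeConjecture.HodgeConjecture`, as in every `Theorems/*.lean` of this sub-problem
set_option linter.dupNamespace false

noncomputable section

open MeasureTheory MeasureTheory.Measure Set NumberField IsDedekindDomain Filter Topology Metric Complex
open scoped NNReal ENNReal ComplexConjugate InnerProductSpace
open Literature.MeasureTheory.Group Literature.NumberTheory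
open Literature.NumberTheory.Automorphic Literature.NumberTheory.Automorphic.UnitaryGroup AdelicGroupData
open Literature.NumberTheory.GaloisRepresentations
open Summit.HodgeConjecture.HodgeConjecture.Cruxes.H413.K2E1BorelEisensteinU
open Summit.HodgeConjecture.HodgeConjecture.Cruxes.H413.K2E1CharacterEisensteinU2Defs
open Summit.HodgeConjecture.HodgeConjecture.Cruxes.H413.K2E1ChiMaassSelbergPairingModelCMTwo (inner_truncatedFamily_eq_fourTerm_chi_model_cm_two)
open Summit.HodgeConjecture.HodgeConjecture.Cruxes.H413.K2E1ChiScatteringRealPolesM1CMTwo (upperBallDomain_topology mem_ball_max_ceil)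
open Summit.HodgeConjecture.HodgeConjecture.Cruxes.H413.K2E1ChiScatteringRealPolesOfModelM1CMTwo (coeFn_sum_smul_ae)
open Summit.HodgeConjecture.HodgeConjecture.Cruxes.H413.K2E1ChiMaassSelbergContinuedModelsCMTwo (real_mul_inner_self differentiableOn_inner_conj_comp)
open Summit.HodgeConjecture.HodgeConjecture.Cruxes.H413.K2E1ConvexDiffCountableConnected (isPreconnected_convex_diff_of_countable)
open Summit.HodgeConjecture.HodgeConjecture.Cruxes.H413.K2E1SphericalEisensteinPoleExclusionCMThree (countable_of_codiscreteWithin countable_ball_diff_of_codiscrete)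
open Summit.HodgeConjecture.HodgeConjecture.Cruxes.H413.K2E1ChiMaassSelbergRealPoleLettersCMTwo (chi_realPole_letters_of_family_selfDual_balls)
open Summit.HodgeConjecture.HodgeConjecture.Cruxes.H413.K2E1ChiMaassSelbergRealPoleCMTwo (normSq_eq_fourTerm_upper normSq_eq_fourTerm_lower exists_chi_L2Residue_real_pole_cm_two)
open Summit.HodgeConjecture.HodgeConjecture.Cruxes.H413.K2E1MaassSelbergResiduePositivity (normSq_residue_le_of_diag residue_real_nonneg_of_diag)

namespace Summit.HodgeConjecture.HodgeConjecture.Cruxes.H413.K2E1ChiMaassSelbergResidueM1CMTwo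

/-! ## §1 Pure preliminaries: the lower ball domain; the `hdiag` equality -/

/-- **TOPOLOGY OF THE LOWER BALL DOMAIN** `D₂ = ({½ < Re, Im < 0} ∩ ball 0 (n+2) ∩ U) ∖ P` (`2 ≤ n`, `U` open co-discrete in the ball, `P` closed countable): open, preconnected, inside
`D⁻`, with two open non-empty sub-tube boxes `O₃ ⊆ {3 < Re < 4}`, `O₄' ⊆ {1 < Re < 2}` — the lower twin of ★ `upperBallDomain_topology` (same proof, `Im ∈ (−1, 0)`).
[cite: MoeglinWaldspurger1995, IV.3.12 (a)] -/
theorem lowerBallDomain_topology (n : ℕ) (hn : 2 ≤ n) {U : Set ℂ} (hUo : IsOpen U) (hUcod : ∀ z₀ ∈ Metric.ball (0 : ℂ) (n + 2), ∀ᶠ s in 𝓝[≠] z₀, s ∈ U)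
    {P : Set ℂ} (hPc : IsClosed P) (hPcount : P.Countable) :
    IsOpen (({z : ℂ | 1 / 2 < z.re ∧ z.im < 0} ∩ Metric.ball (0 : ℂ) (n + 2) ∩ U) \ P) ∧
      IsPreconnected (({z : ℂ | 1 / 2 < z.re ∧ z.im < 0} ∩ Metric.ball (0 : ℂ) (n + 2) ∩ U) \ P) ∧
      ({z : ℂ | 1 / 2 < z.re ∧ z.im < 0} ∩ Metric.ball (0 : ℂ) (n + 2) ∩ U) \ P ⊆ {z : ℂ | 1 / 2 < z.re ∧ z.im < 0} ∧
      ∃ O₃ O₄' : Set ℂ, IsOpen O₃ ∧ O₃.Nonempty ∧ O₃ ⊆ ({z : ℂ | 1 / 2 < z.re ∧ z.im < 0} ∩ Metric.ball (0 : ℂ) (n + 2) ∩ U) \ P ∧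
        IsOpen O₄' ∧ O₄'.Nonempty ∧ O₄' ⊆ ({z : ℂ | 1 / 2 < z.re ∧ z.im < 0} ∩ Metric.ball (0 : ℂ) (n + 2) ∩ U) \ P ∧
        ∀ z ∈ O₃, ∀ z' ∈ O₄', 1 < z'.re ∧ z'.re < z.re := by
  set D₁ : Set ℂ := ({z : ℂ | 1 / 2 < z.re ∧ z.im < 0} ∩ Metric.ball (0 : ℂ) (n + 2) ∩ U) \ P with hD₁def
  set C : Set ℂ := {z : ℂ | 1 / 2 < z.re ∧ z.im < 0} ∩ Metric.ball (0 : ℂ) (n + 2) with hCdef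
  set S : Set ℂ := (Metric.ball (0 : ℂ) (n + 2) \ U) ∪ P with hSdef
  have hQo : IsOpen {z : ℂ | 1 / 2 < z.re ∧ z.im < 0} := (isOpen_lt continuous_const Complex.continuous_re).inter (isOpen_lt Complex.continuous_im continuous_const)
  have hCo : IsOpen C := hQo.inter Metric.isOpen_ball
  have hCc : Convex ℝ C := ((convex_halfSpace_re_gt (1 / 2)).inter (convex_halfSpace_im_lt 0)).inter (convex_ball (0 : ℂ) (n + 2))
  have hSc : S.Countable := (countable_ball_diff_of_codiscrete hUcod).union hPcount
  have hDCS : D₁ = C \ S := by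
    ext z
    simp only [hD₁def, hCdef, hSdef, Set.mem_sdiff, Set.mem_inter_iff, Set.mem_union, not_or, not_and, not_not]
    constructor
    · rintro ⟨⟨⟨hq, hb⟩, hU⟩, hP⟩
      exact ⟨⟨hq, hb⟩, fun _ => hU, hP⟩
    · rintro ⟨⟨hq, hb⟩, hU, hP⟩
      exact ⟨⟨⟨hq, hb⟩, hU hb⟩, hP⟩
  have hD₁o : IsOpen D₁ := (hCo.inter hUo).sdiff hPc
  have hD₁c : IsPreconnected D₁ := by
    rw [hDCS]
    exact isPreconnected_convex_diff_of_countable Literature.Topology.Euclidean.one_lt_rank_real_complex hCc hCo hSc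
  have hD₁sub : D₁ ⊆ {z : ℂ | 1 / 2 < z.re ∧ z.im < 0} := fun z hz => hz.1.1.1
  have hn' : (2 : ℝ) ≤ n := by exact_mod_cast hn
  have hdense : Dense Sᶜ := hSc.dense_compl ℝ
  have hbox : ∀ (a₁ b₁ : ℝ) (w : ℂ), a₁ < w.re → w.re < b₁ → -1 < w.im → w.im < 0 → 1 / 2 < w.re → ‖w‖ < n + 2 →
      IsOpen (D₁ ∩ {z : ℂ | (a₁ < z.re ∧ z.re < b₁) ∧ (-1 < z.im ∧ z.im < 0)}) ∧ (D₁ ∩ {z : ℂ | (a₁ < z.re ∧ z.re < b₁) ∧ (-1 < z.im ∧ z.im < 0)}).Nonempty := by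
    intro a₁ b₁ w h1 h2 h3 h4 h5 h6
    have hBo : IsOpen {z : ℂ | (a₁ < z.re ∧ z.re < b₁) ∧ (-1 < z.im ∧ z.im < 0)} :=
      ((isOpen_lt continuous_const Complex.continuous_re).inter (isOpen_lt Complex.continuous_re continuous_const)).inter
        ((isOpen_lt continuous_const Complex.continuous_im).inter (isOpen_lt Complex.continuous_im continuous_const))
    refine ⟨hD₁o.inter hBo, ?_⟩
    have hwC : w ∈ C ∩ {z : ℂ | (a₁ < z.re ∧ z.re < b₁) ∧ (-1 < z.im ∧ z.im < 0)} := ⟨⟨⟨h5, h4⟩, mem_ball_zero_iff.2 h6⟩, ⟨h1, h2⟩, ⟨h3, h4⟩⟩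
    obtain ⟨z, ⟨hzC, hzB⟩, hzS⟩ := hdense.inter_open_nonempty _ (hCo.inter hBo) ⟨w, hwC⟩
    refine ⟨z, ⟨?_, hzB⟩⟩
    rw [hDCS]
    exact ⟨hzC, hzS⟩
  have hw₁ : ‖(⟨31 / 10, -(1 / 10)⟩ : ℂ)‖ < n + 2 :=
    lt_of_le_of_lt (Complex.norm_le_abs_re_add_abs_im _) (by norm_num [abs_of_pos, abs_of_neg]; linarith)
  have hw₂ : ‖(⟨11 / 10, -(1 / 10)⟩ : ℂ)‖ < n + 2 :=
    lt_of_le_of_lt (Complex.norm_le_abs_re_add_abs_im _) (by norm_num [abs_of_pos, abs_of_neg]; linarith)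
  obtain ⟨hO₁o, hO₁ne⟩ := hbox 3 4 ⟨31 / 10, -(1 / 10)⟩ (by norm_num) (by norm_num) (by norm_num) (by norm_num) (by norm_num) hw₁
  obtain ⟨hO₂o, hO₂ne⟩ := hbox 1 2 ⟨11 / 10, -(1 / 10)⟩ (by norm_num) (by norm_num) (by norm_num) (by norm_num) (by norm_num) hw₂
  have hsep : ∀ z ∈ D₁ ∩ {z : ℂ | (3 < z.re ∧ z.re < 4) ∧ (-1 < z.im ∧ z.im < 0)}, ∀ z' ∈ D₁ ∩ {z : ℂ | (1 < z.re ∧ z.re < 2) ∧ (-1 < z.im ∧ z.im < 0)}, 1 < z'.re ∧ z'.re < z.re :=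
    fun z hz z' hz' => ⟨hz'.2.1.1, by linarith [hz'.2.1.2, hz.2.1.1]⟩
  exact ⟨hD₁o, hD₁c, hD₁sub, _, _, hO₁o, hO₁ne, Set.inter_subset_left, hO₂o, hO₂ne, Set.inter_subset_left, hsep⟩

/-- **THE `hdiag` EQUALITY NEAR A REAL POINT** from the two diagonal identities on an upper and a lower domain that carry the punctured neighbourhoods off the axis. [cite: MoeglinWaldspurger1995, IV.2.3] -/
theorem eventually_normSq_eq_fourTerm {H : Type*} [NormedAddCommGroup H] {T cμ K : ℝ} {a : ℝ} {b : ℂ → ℝ} {B₃ : ℂ → ℂ} (F : ℂ → H) {D₁ D₂ : Set ℂ} {c : ℝ}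
    (h₁ : ∀ z ∈ D₁, (((‖F z‖ ^ 2 : ℝ)) : ℂ) = ((cμ : ℝ) : ℂ) * (((K : ℝ) : ℂ) *
        ((((T : ℝ) : ℂ) ^ (z + conj z - 1) / (z + conj z - 1)) * ((a : ℝ) : ℂ)
          + (((T : ℝ) : ℂ) ^ (z - conj z) / (z - conj z)) * conj (B₃ z)
          - (((T : ℝ) : ℂ) ^ (-(z - conj z)) / (z - conj z)) * B₃ z
          - (((T : ℝ) : ℂ) ^ (-(z + conj z - 1)) / (z + conj z - 1)) * ((b z : ℝ) : ℂ))))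
    (h₂ : ∀ z ∈ D₂, (((‖F z‖ ^ 2 : ℝ)) : ℂ) = ((cμ : ℝ) : ℂ) * (((K : ℝ) : ℂ) *
        ((((T : ℝ) : ℂ) ^ (z + conj z - 1) / (z + conj z - 1)) * ((a : ℝ) : ℂ)
          + (((T : ℝ) : ℂ) ^ (z - conj z) / (z - conj z)) * conj (B₃ z)
          - (((T : ℝ) : ℂ) ^ (-(z - conj z)) / (z - conj z)) * B₃ z
          - (((T : ℝ) : ℂ) ^ (-(z + conj z - 1)) / (z + conj z - 1)) * ((b z : ℝ) : ℂ))))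
    (hup : ∀ᶠ z : ℂ in 𝓝[≠] (c : ℂ), 0 < z.im → z ∈ D₁) (hlo : ∀ᶠ z : ℂ in 𝓝[≠] (c : ℂ), z.im < 0 → z ∈ D₂) :
    ∀ᶠ z : ℂ in 𝓝[≠] (c : ℂ), z.im ≠ 0 → (((‖F z‖ ^ 2 : ℝ)) : ℂ) =
      ((cμ : ℝ) : ℂ) * (((K : ℝ) : ℂ) *
        ((((T : ℝ) : ℂ) ^ (z + conj z - 1) / (z + conj z - 1)) * ((a : ℝ) : ℂ)
          + (((T : ℝ) : ℂ) ^ (z - conj z) / (z - conj z)) * conj (B₃ z)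
          - (((T : ℝ) : ℂ) ^ (-(z - conj z)) / (z - conj z)) * B₃ z
          - (((T : ℝ) : ℂ) ^ (-(z + conj z - 1)) / (z + conj z - 1)) * ((b z : ℝ) : ℂ))) := by
  filter_upwards [hup, hlo] with z hzu hzl hzim
  rcases lt_or_gt_of_ne hzim with hlt | hgt
  · exact h₂ z (hzl hlt)
  · exact h₁ z (hzu hgt)

/-- **THE SELF-DUAL BRACKET LETTERS** of ★ `poleControl_continued_chi_cm_two_of_family_on'` for `B₁ = κ⟪φ,φ⟫`, `B₂ = κ⟪ψ ·, φ⟫`, `B₃ = κ⟪φ, ψ ·⟫`, `B₄ = κ⟪ψ ·′, ψ ·⟫` (`m = 1`) on an open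
`D` where `ψ` is holomorphic — ★ p860605's derivation, stated once for any `ψ`. [cite: MoeglinWaldspurger1995, IV.2.3] -/
theorem selfDual_brackets {V : Type*} [NormedAddCommGroup V] [InnerProductSpace ℂ V] (κ : ℝ) (φ : V) (ψ : ℂ → V) {D : Set ℂ} (hD : IsOpen D) (hψ : DifferentiableOn ℂ ψ D) :
    DifferentiableOn ℂ (fun w : ℂ => ((κ : ℝ) : ℂ) * (((1 : ℝ) : ℂ) * ⟪ψ (conj w), φ⟫_ℂ)) {w : ℂ | conj w ∈ D} ∧
      DifferentiableOn ℂ (fun z : ℂ => ((κ : ℝ) : ℂ) * (((1 : ℝ) : ℂ) * ⟪φ, ψ z⟫_ℂ)) D ∧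
      (∀ z ∈ D, ((κ : ℝ) : ℂ) * (((1 : ℝ) : ℂ) * ⟪φ, ψ z⟫_ℂ) = conj (((κ : ℝ) : ℂ) * (((1 : ℝ) : ℂ) * ⟪ψ z, φ⟫_ℂ))) ∧
      (∀ z' ∈ D, DifferentiableOn ℂ (fun z : ℂ => ((κ : ℝ) : ℂ) * (((1 : ℝ) : ℂ) * ⟪ψ z', ψ z⟫_ℂ)) D) ∧
      (∀ z ∈ D, DifferentiableOn ℂ (fun w : ℂ => ((κ : ℝ) : ℂ) * (((1 : ℝ) : ℂ) * ⟪ψ (conj w), ψ z⟫_ℂ)) {w : ℂ | conj w ∈ D}) ∧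
      (∀ z ∈ D, ((κ : ℝ) : ℂ) * (((1 : ℝ) : ℂ) * ⟪ψ z, ψ z⟫_ℂ) = (((κ * 1 * ‖ψ z‖ ^ 2 : ℝ)) : ℂ)) := by
  refine ⟨((differentiableOn_inner_conj_comp hD hψ φ).const_mul _).const_mul _,
    (((innerSL ℂ φ).differentiable.comp_differentiableOn hψ).const_mul _).const_mul _, fun z _ => ?_,
    fun z' _ => (((innerSL ℂ (ψ z')).differentiable.comp_differentiableOn hψ).const_mul _).const_mul _,
    fun z _ => ((differentiableOn_inner_conj_comp hD hψ (ψ z)).const_mul _).const_mul _, fun z _ => real_mul_inner_self κ 1 (ψ z)⟩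
  rw [map_mul, map_mul, Complex.conj_ofReal, Complex.conj_ofReal, inner_conj_symm]

/-! ## §2 HEAD: the M1 residue print -/

variable (L : Type) [Field L] [NumberField L] [IsCMField L]
variable [MeasurableSpace (quasiSplit (↥(maximalRealSubfield L)) L (IsCMField.complexConj L) 2).Adelic] [BorelSpace (quasiSplit (↥(maximalRealSubfield L)) L (IsCMField.complexConj L) 2).Adelic]
variable [MeasurableSpace (AdeleRing (𝓞 L) L)ˣ] [BorelSpace (AdeleRing (𝓞 L) L)ˣ]

set_option maxHeartbeats 400000 in -- BF-N27 measured: lake batch 28.593 whnf timeout at 200000 (:173); farm-direct cost of this HEAD ∈ (185000, 200000] (probes 185000 ✗ ∕ 200000 ✓); passes at 400000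
/-- **THE M1 RESIDUE PRINT.**  Binders: ★ `chi_scattering_noComplexPole_of_model_m1_cm_two`'s VERBATIM, plus the rank-one identification `hbKφ : ∀ j, bK j = φK` and `hconj`.  For every real
`c > ½`, on the ball `n = max 2 ⌈‖c‖⌉₊`: (i) every `(z − c)·qc_j` extends analytically across `c` (AT MOST SIMPLE POLES); (ii) the `L²`-RESIDUE `u = lim_{z → c, z ≠ c} (z − c)•Fam n z`
exists; (iii) the residue `r = lim (z − c)·κ⟪φK, ψ z⟫` of the scattering pairing (`ψ z = Σ_j qc_j z • bK j`, `κ` the idelic bracket constant) exists, is REAL and NON-NEGATIVE, and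
`‖u‖² ≤ cμ·K·Re r` for the Maass–Selberg constants `cμ, K > 0` of ★ B2 on that ball. [cite: MoeglinWaldspurger1995, IV.1.11, IV.3.12 (a)] [cite: Langlands1976, §7] -/
theorem chi_maassSelberg_residue_m1_cm_two
    (μ : Measure (quasiSplit (↥(maximalRealSubfield L)) L (IsCMField.complexConj L) 2).automorphicQuotient) [(quasiSplit (↥(maximalRealSubfield L)) L (IsCMField.complexConj L) 2).IsAutomorphicMeasure μ]
    (νG : Measure (quasiSplit (↥(maximalRealSubfield L)) L (IsCMField.complexConj L) 2).Adelic) [νG.IsHaarMeasure] [νG.IsInvInvariant]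
    (μK : Measure ((standardMaximalCompactGL 2 L).comap (adelicVal (↥(maximalRealSubfield L)) L (IsCMField.complexConj L) 2 ((StdForm.antidiagonal 2).over L)) : Subgroup (quasiSplit (↥(maximalRealSubfield L)) L (IsCMField.complexConj L) 2).Adelic)) [μK.IsHaarMeasure]
    (νI : Measure (AdeleRing (𝓞 L) L)ˣ) [νI.IsHaarMeasure]
    {𝓕I : Set (AdeleRing (𝓞 L) L)ˣ} (h𝓕I : IsIdeleClassDomain L 𝓕I)
    (ν : Measure ↥(adelicUnipotent (↥(maximalRealSubfield L)) L (IsCMField.complexConj L) 2)) [ν.IsHaarMeasure]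
    {𝓕 : Set ↥(adelicUnipotent (↥(maximalRealSubfield L)) L (IsCMField.complexConj L) 2)} (h𝓕N : IsFundamentalDomain ↥(rationalUnipotent (↥(maximalRealSubfield L)) L (IsCMField.complexConj L) 2) 𝓕 ν) (h𝓕1 : ν 𝓕 = 1)
    (h𝓕c : IsCompact (closure 𝓕))
    {β : (quasiSplit (↥(maximalRealSubfield L)) L (IsCMField.complexConj L) 2).Adelic → ℝ≥0∞} (hβ : IsCoveringWeight ((arithmeticBorel (↥(maximalRealSubfield L)) L (IsCMField.complexConj L) 2).map (quasiSplit (↥(maximalRealSubfield L)) L (IsCMField.complexConj L) 2).arithmeticSubgroup.subtype) β)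
    -- the self-dual unitary character and the M1 section
    {χ : HeckeCharacter L} (hχ : χ.IsUnitary) (hρ : ∀ r : ℝ≥0ˣ, χ (posRealIdele L r) = 1) (hsd : reflectChar (IsCMField.complexConj L) χ = χ)
    {φ : (quasiSplit (↥(maximalRealSubfield L)) L (IsCMField.complexConj L) 2).Adelic → ℂ} (hφc : Continuous φ) (hφ : IsChiSection χ φ) {Cφ : ℝ} (hφC : ∀ x, ‖φ x‖ ≤ Cφ)
    -- the meromorphic package (★ M1 print ∕ (α) family export clause shapes): basis functions `b j`, tube coordinates `q j`, continued `qc j`, `Ec`, pole set `P`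
    {ι' : Type} [Fintype ι'] (b : ι' → (quasiSplit (↥(maximalRealSubfield L)) L (IsCMField.complexConj L) 2).Adelic → ℂ) {q qc : ι' → ℂ → ℂ} {Ec : ℂ → (quasiSplit (↥(maximalRealSubfield L)) L (IsCMField.complexConj L) 2).Adelic → ℂ} {P : Set ℂ}
    (hqφ : ∀ z : ℂ, 1 < z.re → (∑ j, q j z • b j) = ((((ν 𝓕).toReal⁻¹ : ℝ)) : ℂ) • (fun g : (quasiSplit (↥(maximalRealSubfield L)) L (IsCMField.complexConj L) 2).Adelic => (∫ v : ↥(adelicUnipotent (↥(maximalRealSubfield L)) L (IsCMField.complexConj L) 2), flatSectionU φ z ((quasiSplit (↥(maximalRealSubfield L)) L (IsCMField.complexConj L) 2).toAdelic (weylLongU ((IsCMField.complexConj L : L ≃ₐ[↥(maximalRealSubfield L)] L) : L →+* L) (rfl : (StdForm.antidiagonal 2).over L = (StdForm.antidiagonal 2).over L)) * ((v : (quasiSplit (↥(maximalRealSubfield L)) L (IsCMField.complexConj L) 2).Adelic) * g)) ∂ν) * ((borelHeight g : ℝ) : ℂ) ^ (z - 1)))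
    (hqNF : ∀ j, MeromorphicNFOn (qc j) univ) (hE1 : ∀ z : ℂ, 1 < z.re → Ec z = eisensteinSeriesU (flatSectionU φ z)) (hqcq : ∀ j (z : ℂ), 1 < z.re → qc j z = q j z)
    (hPc : IsClosed P) (hPcd : ∀ z₀ : ℂ, ∀ᶠ s in 𝓝[≠] z₀, s ∉ P) (hqa : ∀ j (z : ℂ), z ∉ P → AnalyticAt ℂ (qc j) z)
    -- the `L²(K_U)` classes of `φ` and of the basis, and the idelic bracket constant
    (φK : Lp ℂ 2 μK) (hφK : ((φK : Lp ℂ 2 μK) : _ → ℂ) =ᵐ[μK] fun k => φ (k : (quasiSplit (↥(maximalRealSubfield L)) L (IsCMField.complexConj L) 2).Adelic)) (hφK0 : φK ≠ 0)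
    (bK : ι' → Lp ℂ 2 μK) (hbK : ∀ j, ((bK j : Lp ℂ 2 μK) : _ → ℂ) =ᵐ[μK] fun k => b j (k : (quasiSplit (↥(maximalRealSubfield L)) L (IsCMField.complexConj L) 2).Adelic)) (hbKli : LinearIndependent ℂ bK)
    (hκ : 0 < (∫ x in {x : (AdeleRing (𝓞 L) L)ˣ | (IdeleClassGroup.ideleNorm L x : ℝ) ≤ 1} ∩ 𝓕I, (IdeleClassGroup.ideleNorm L x : ℝ) ∂νI))
    -- the per-ball truncated families of the SAME `Ec` ((α) export clause shapes) and the survivor `hdec′`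
    (U : ℕ → Set ℂ) (hUo : ∀ n, IsOpen (U n)) (hUcod : ∀ n : ℕ, ∀ z₀ ∈ Metric.ball (0 : ℂ) (n + 2), ∀ᶠ s in 𝓝[≠] z₀, s ∈ U n)
    (T₀ : ℕ → ℝ≥0) (hT₀ : ∀ n, 1 ≤ T₀ n) (Fam : ℕ → ℂ → Lp ℂ 2 μ) (hFd : ∀ n, DifferentiableOn ℂ (Fam n) (U n \ P))
    (hFam : ∀ n, ∀ z ∈ U n \ P, ((Fam n z : Lp ℂ 2 μ) : (quasiSplit (↥(maximalRealSubfield L)) L (IsCMField.complexConj L) 2).automorphicQuotient → ℂ) =ᵐ[μ] (quasiSplit (↥(maximalRealSubfield L)) L (IsCMField.complexConj L) 2).quotFun (truncation ν 𝓕 (T₀ n) (Ec z)))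
    (hdec' : ∀ (n : ℕ) (z' : ℂ), 1 < z'.re → ∃ M₁ : ℝ, ∀ g : (quasiSplit (↥(maximalRealSubfield L)) L (IsCMField.complexConj L) 2).Adelic, T₀ n < borelHeight g →
      ‖eisensteinSeriesU (flatSectionU φ z') g - borelConstantTerm ν 𝓕 (eisensteinSeriesU (flatSectionU φ z')) g‖ ≤ M₁)
    (hconj : ∀ j (z : ℂ), z ∉ P → conj z ∉ P → qc j (conj z) = conj (qc j z))
    (hbKφ : ∀ j, bK j = φK)
    {c : ℝ} (hc : 1 / 2 < c) :
    (∀ j, ∃ d : ℂ → ℂ, AnalyticAt ℂ d (c : ℂ) ∧ ∀ᶠ z : ℂ in 𝓝[≠] (c : ℂ), d z = (z - c) * qc j z) ∧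
    ∃ (u : Lp ℂ 2 μ) (r : ℂ) (cμ K : ℝ), 0 < cμ ∧ 0 < K ∧
      Tendsto (fun z : ℂ => (z - c) • Fam (max 2 ⌈‖(c : ℂ)‖⌉₊) z) (𝓝[≠] (c : ℂ)) (𝓝 u) ∧
      Tendsto (fun z : ℂ => (z - c) * ((((∫ x in {x : (AdeleRing (𝓞 L) L)ˣ | (IdeleClassGroup.ideleNorm L x : ℝ) ≤ 1} ∩ 𝓕I, (IdeleClassGroup.ideleNorm L x : ℝ) ∂νI) : ℝ) : ℂ) * (((1 : ℝ) : ℂ) * ⟪φK, ∑ j, qc j z • bK j⟫_ℂ))) (𝓝[≠] (c : ℂ)) (𝓝 r) ∧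
      r.im = 0 ∧ 0 ≤ r.re ∧ ‖u‖ ^ 2 ≤ cμ * K * r.re := by
  classical
  -- the tube identity of the model section `ψ z := Σ_j qc_j(z) • bK_j` (★ OfModel)
  have h1r : ((((ν 𝓕).toReal⁻¹ : ℝ)) : ℂ) = 1 := by rw [h𝓕1, ENNReal.toReal_one, inv_one, Complex.ofReal_one]
  have hψtube : ∀ z : ℂ, 1 < z.re → ((∑ j, qc j z • bK j : Lp ℂ 2 μK) : _ → ℂ) =ᵐ[μK] fun k => (fun g : (quasiSplit (↥(maximalRealSubfield L)) L (IsCMField.complexConj L) 2).Adelic => (∫ v : ↥(adelicUnipotent (↥(maximalRealSubfield L)) L (IsCMField.complexConj L) 2), flatSectionU φ z ((quasiSplit (↥(maximalRealSubfield L)) L (IsCMField.complexConj L) 2).toAdelic (weylLongU ((IsCMField.complexConj L : L ≃ₐ[↥(maximalRealSubfield L)] L) : L →+* L) (rfl : (StdForm.antidiagonal 2).over L = (StdForm.antidiagonal 2).over L)) * ((v : (quasiSplit (↥(maximalRealSubfield L)) L (IsCMField.complexConj L) 2).Adelic) * g)) ∂ν) * ((borelHeight g : ℝ) : ℂ) ^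 (z - 1)) (k : (quasiSplit (↥(maximalRealSubfield L)) L (IsCMField.complexConj L) 2).Adelic) := by
    intro z hz
    refine (coeFn_sum_smul_ae Finset.univ (fun j => qc j z) bK (fun j k => b j (k : (quasiSplit (↥(maximalRealSubfield L)) L (IsCMField.complexConj L) 2).Adelic)) hbK).trans (Eventually.of_forall fun k => ?_)
    have happ := congrFun (hqφ z hz) (k : (quasiSplit (↥(maximalRealSubfield L)) L (IsCMField.complexConj L) 2).Adelic)
    rw [Finset.sum_apply, Pi.smul_apply, h1r, one_smul] at happ
    simp only [Pi.smul_apply, smul_eq_mul] at happ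
    beta_reduce
    rw [← happ]
    exact Finset.sum_congr rfl fun j _ => by rw [hqcq j z hz]
  -- the ball at `c`
  set n : ℕ := max 2 ⌈‖(c : ℂ)‖⌉₊ with hndef
  have hn : 2 ≤ n := le_max_left _ _
  have hcb : (c : ℂ) ∈ Metric.ball (0 : ℂ) (n + 2) := mem_ball_max_ceil (c : ℂ)
  have hPcount : P.Countable := countable_of_codiscreteWithin fun x _ => hPcd x
  -- the whole holomorphy domain `W(n)`, the upper and lower quarter-domains
  have hsubW : ∀ k : ℕ, (({z : ℂ | 1 / 2 < z.re} ∩ Metric.ball (0 : ℂ) (k + 2) ∩ U k) \ P) ⊆ U k \ P := fun k z hz => ⟨hz.1.2, hz.2⟩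
  have hFtubeW : ∀ k : ℕ, ∀ z ∈ (({z : ℂ | 1 / 2 < z.re} ∩ Metric.ball (0 : ℂ) (k + 2) ∩ U k) \ P), 1 < z.re →
      ((Fam k z : Lp ℂ 2 μ) : (quasiSplit (↥(maximalRealSubfield L)) L (IsCMField.complexConj L) 2).automorphicQuotient → ℂ) =ᵐ[μ] (quasiSplit (↥(maximalRealSubfield L)) L (IsCMField.complexConj L) 2).quotFun (truncation ν 𝓕 (T₀ k) (eisensteinSeriesU (flatSectionU φ z))) := by
    intro k z hz hz1
    rw [← hE1 z hz1]
    exact hFam k z (hsubW k hz)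
  -- ★ B2 on `W(k)`, ball by ball (ONE pair of constants per ball, valid on both half-planes)
  choose cμ K hcμ hK hrelW using fun k : ℕ =>
    inner_truncatedFamily_eq_fourTerm_chi_model_cm_two L μ νG μK νI h𝓕I ν h𝓕N h𝓕1 h𝓕c hβ (hT₀ k) hχ hρ hφc hφ hφC hφc hφ hφC (hdec' k) (Fam k) (Fam k) (hFtubeW k) (hFtubeW k)
      hsd φK φK hφK hφK (fun z => ∑ j, qc j z • bK j) (fun z => ∑ j, qc j z • bK j) (fun z _ hz => hψtube z hz) (fun z _ hz => hψtube z hz)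
  have hUW : ∀ k : ℕ, (({z : ℂ | 1 / 2 < z.re ∧ 0 < z.im} ∩ Metric.ball (0 : ℂ) (k + 2) ∩ U k) \ P) ⊆ (({z : ℂ | 1 / 2 < z.re} ∩ Metric.ball (0 : ℂ) (k + 2) ∩ U k) \ P) :=
    fun k z hz => ⟨⟨⟨hz.1.1.1.1, hz.1.1.2⟩, hz.1.2⟩, hz.2⟩
  have hLW : (({z : ℂ | 1 / 2 < z.re ∧ z.im < 0} ∩ Metric.ball (0 : ℂ) (n + 2) ∩ U n) \ P) ⊆ (({z : ℂ | 1 / 2 < z.re} ∩ Metric.ball (0 : ℂ) (n + 2) ∩ U n) \ P) := fun z hz => ⟨⟨⟨hz.1.1.1.1, hz.1.1.2⟩, hz.1.2⟩, hz.2⟩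
  have hrelU : ∀ k : ℕ, 2 ≤ k → ∀ z ∈ (({z : ℂ | 1 / 2 < z.re ∧ 0 < z.im} ∩ Metric.ball (0 : ℂ) (k + 2) ∩ U k) \ P), ∀ z' ∈ (({z : ℂ | 1 / 2 < z.re ∧ 0 < z.im} ∩ Metric.ball (0 : ℂ) (k + 2) ∩ U k) \ P), 1 < z'.re → z'.re < z.re →
      ⟪Fam k z', Fam k z⟫_ℂ = (cμ k : ℂ) * ((K k : ℂ) *
        (((((T₀ k : ℝ≥0) : ℝ) : ℂ) ^ (z + conj z' - 1) / (z + conj z' - 1)) * ((((∫ x in {x : (AdeleRing (𝓞 L) L)ˣ | (IdeleClassGroup.ideleNorm L x : ℝ) ≤ 1} ∩ 𝓕I, (IdeleClassGroup.ideleNorm L x : ℝ) ∂νI) : ℝ) : ℂ) * (((1 : ℝ) : ℂ) * ⟪φK, φK⟫_ℂ))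
          + ((((T₀ k : ℝ≥0) : ℝ) : ℂ) ^ (z - conj z') / (z - conj z')) * ((((∫ x in {x : (AdeleRing (𝓞 L) L)ˣ | (IdeleClassGroup.ideleNorm L x : ℝ) ≤ 1} ∩ 𝓕I, (IdeleClassGroup.ideleNorm L x : ℝ) ∂νI) : ℝ) : ℂ) * (((1 : ℝ) : ℂ) * ⟪(fun z => ∑ j, qc j z • bK j) z', φK⟫_ℂ))
          - ((((T₀ k : ℝ≥0) : ℝ) : ℂ) ^ (-(z - conj z')) / (z - conj z')) * ((((∫ x in {x : (AdeleRing (𝓞 L) L)ˣ | (IdeleClassGroup.ideleNorm L x : ℝ) ≤ 1} ∩ 𝓕I, (IdeleClassGroup.ideleNorm L x : ℝ) ∂νI) : ℝ) : ℂ) * (((1 : ℝ) : ℂ) * ⟪φK, (fun z => ∑ j, qc j z • bK j) z⟫_ℂ))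
          - ((((T₀ k : ℝ≥0) : ℝ) : ℂ) ^ (-(z + conj z' - 1)) / (z + conj z' - 1)) * ((((∫ x in {x : (AdeleRing (𝓞 L) L)ˣ | (IdeleClassGroup.ideleNorm L x : ℝ) ≤ 1} ∩ 𝓕I, (IdeleClassGroup.ideleNorm L x : ℝ) ∂νI) : ℝ) : ℂ) * (((1 : ℝ) : ℂ) * ⟪(fun z => ∑ j, qc j z • bK j) z', (fun z => ∑ j, qc j z • bK j) z⟫_ℂ)))) :=
    fun k _ z hz z' hz' h1 h2 => hrelW k z (hUW k hz) z' (hUW k hz') h1 h2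
  -- (i) the pole letters at `c` on the ball `n` (★ p860774 on ★ p860605's letter block)
  have hsubU : ∀ k : ℕ, (({z : ℂ | 1 / 2 < z.re ∧ 0 < z.im} ∩ Metric.ball (0 : ℂ) (k + 2) ∩ U k) \ P) ⊆ U k \ P := fun k z hz => ⟨hz.1.2, hz.2⟩
  obtain ⟨hdj, ⟨d, hda, hde⟩, hb⟩ := chi_realPole_letters_of_family_selfDual_balls (V := Lp ℂ 2 μK) hPc hPcd hqNF hqa hbKli one_ne_zero
    (ψ := (fun z => ∑ j, qc j z • bK j)) (fun z _ => (one_smul ℂ _).symm) hκ one_pos hφK0 U hUo hUcod (T := fun k => ((T₀ k : ℝ≥0) : ℝ)) (fun k => by exact_mod_cast hT₀ k)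
    hcμ hK Fam (fun k _ => (hFd k).mono (hsubU k)) hrelU hc
  refine ⟨hdj, ?_⟩
  -- the two quarter-domains at the ball `n`
  obtain ⟨hDUo, hDUc, hDUsub, O₁, O₂', hO₁o, hO₁ne, hO₁D, hO₂o, hO₂ne, hO₂D, hsep₁⟩ := upperBallDomain_topology n hn (hUo n) (hUcod n) hPc hPcount
  obtain ⟨hDLo, hDLc, hDLsub, O₃, O₄', hO₃o, hO₃ne, hO₃D, hO₄o, hO₄ne, hO₄D, hsep₂⟩ := lowerBallDomain_topology n hn (hUo n) (hUcod n) hPc hPcount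
  have hsubL : (({z : ℂ | 1 / 2 < z.re ∧ z.im < 0} ∩ Metric.ball (0 : ℂ) (n + 2) ∩ U n) \ P) ⊆ U n \ P := fun z hz => ⟨hz.1.2, hz.2⟩
  have hψd : ∀ D : Set ℂ, D ⊆ U n \ P → DifferentiableOn ℂ (fun z => ∑ j, qc j z • bK j) D := fun D hD =>
    DifferentiableOn.fun_sum fun i _ => fun z hz => ((hqa i z (hD hz).2).differentiableAt.differentiableWithinAt).smul_const (bK i)
  have hψU : DifferentiableOn ℂ (fun z => ∑ j, qc j z • bK j) (({z : ℂ | 1 / 2 < z.re ∧ 0 < z.im} ∩ Metric.ball (0 : ℂ) (n + 2) ∩ U n) \ P) := hψd _ (hsubU n)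
  have hψL : DifferentiableOn ℂ (fun z => ∑ j, qc j z • bK j) (({z : ℂ | 1 / 2 < z.re ∧ z.im < 0} ∩ Metric.ball (0 : ℂ) (n + 2) ∩ U n) \ P) := hψd _ hsubL
  -- the bracket regularity on both domains (as ★ p860605's self-dual head)
  obtain ⟨hB₂U, hB₃U, hB₃₂U, hB₄₁U, hB₄₂U, hB₄dU⟩ := selfDual_brackets (∫ x in {x : (AdeleRing (𝓞 L) L)ˣ | (IdeleClassGroup.ideleNorm L x : ℝ) ≤ 1} ∩ 𝓕I, (IdeleClassGroup.ideleNorm L x : ℝ) ∂νI) φK (fun z => ∑ j, qc j z • bK j) hDUo hψU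
  obtain ⟨hB₂L, hB₃L, hB₃₂L, hB₄₁L, hB₄₂L, hB₄dL⟩ := selfDual_brackets (∫ x in {x : (AdeleRing (𝓞 L) L)ˣ | (IdeleClassGroup.ideleNorm L x : ℝ) ≤ 1} ∩ 𝓕I, (IdeleClassGroup.ideleNorm L x : ℝ) ∂νI) φK (fun z => ∑ j, qc j z • bK j) hDLo hψL
  -- the restricted relations
  have hrel₁ := fun z (hz : z ∈ (({z : ℂ | 1 / 2 < z.re ∧ 0 < z.im} ∩ Metric.ball (0 : ℂ) (n + 2) ∩ U n) \ P)) z' (hz' : z' ∈ (({z : ℂ | 1 / 2 < z.re ∧ 0 < z.im} ∩ Metric.ball (0 : ℂ) (n + 2) ∩ U n) \ P)) (h1 : 1 < z'.re) (h2 : z'.re < z.re) => hrelW n z (hUW n hz) z' (hUW n hz') h1 h2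
  have hrel₂ := fun z (hz : z ∈ (({z : ℂ | 1 / 2 < z.re ∧ z.im < 0} ∩ Metric.ball (0 : ℂ) (n + 2) ∩ U n) \ P)) z' (hz' : z' ∈ (({z : ℂ | 1 / 2 < z.re ∧ z.im < 0} ∩ Metric.ball (0 : ℂ) (n + 2) ∩ U n) \ P)) (h1 : 1 < z'.re) (h2 : z'.re < z.re) => hrelW n z (hLW hz) z' (hLW hz') h1 h2
  -- the punctured neighbourhoods of `c`
  have hT0 : 0 < ((T₀ n : ℝ≥0) : ℝ) := lt_of_lt_of_le one_pos (by exact_mod_cast hT₀ n)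
  have hVo : IsOpen (U n \ P) := (hUo n).sdiff hPc
  have hmem : ∀ᶠ z : ℂ in 𝓝[≠] (c : ℂ), z ∈ U n \ P := by
    filter_upwards [hUcod n (c : ℂ) hcb, hPcd (c : ℂ)] with z hzU hzP
    exact ⟨hzU, hzP⟩
  have hre : ∀ᶠ z : ℂ in 𝓝[≠] (c : ℂ), 1 / 2 < z.re :=
    mem_nhdsWithin_of_mem_nhds ((isOpen_lt continuous_const Complex.continuous_re).mem_nhds (by simpa using hc))
  have hball : ∀ᶠ z : ℂ in 𝓝[≠] (c : ℂ), z ∈ Metric.ball (0 : ℂ) (n + 2) := mem_nhdsWithin_of_mem_nhds (Metric.isOpen_ball.mem_nhds hcb)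
  have hup : ∀ᶠ z : ℂ in 𝓝[≠] (c : ℂ), 0 < z.im → z ∈ (({z : ℂ | 1 / 2 < z.re ∧ 0 < z.im} ∩ Metric.ball (0 : ℂ) (n + 2) ∩ U n) \ P) := by
    filter_upwards [hre, hball, hmem] with z h1 h2 h3 him
    exact ⟨⟨⟨⟨h1, him⟩, h2⟩, h3.1⟩, h3.2⟩
  have hlo : ∀ᶠ z : ℂ in 𝓝[≠] (c : ℂ), z.im < 0 → z ∈ (({z : ℂ | 1 / 2 < z.re ∧ z.im < 0} ∩ Metric.ball (0 : ℂ) (n + 2) ∩ U n) \ P) := by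
    filter_upwards [hre, hball, hmem] with z h1 h2 h3 him
    exact ⟨⟨⟨⟨h1, him⟩, h2⟩, h3.1⟩, h3.2⟩
  -- the scattering pairing is REAL on the real axis near `c` (rank one + `hconj`)
  have hψφ : ∀ z : ℂ, (∑ j, qc j z • bK j) = (∑ j, qc j z) • φK := fun z => by
    rw [Finset.sum_smul]; exact Finset.sum_congr rfl fun j _ => by rw [hbKφ j]
  have hrealB : ∀ᶠ x : ℝ in 𝓝[≠] c, ((((∫ x in {x : (AdeleRing (𝓞 L) L)ˣ | (IdeleClassGroup.ideleNorm L x : ℝ) ≤ 1} ∩ 𝓕I, (IdeleClassGroup.ideleNorm L x : ℝ) ∂νI) : ℝ) : ℂ) * (((1 : ℝ) : ℂ) * ⟪φK, (fun z => ∑ j, qc j z • bK j) (x : ℂ)⟫_ℂ)).im = 0 := by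
    have ht : Tendsto (fun x : ℝ => (x : ℂ)) (𝓝[≠] c) (𝓝[≠] (c : ℂ)) := by
      refine tendsto_nhdsWithin_of_tendsto_nhds_of_eventually_within _ ((continuous_ofReal.tendsto c).mono_left nhdsWithin_le_nhds) ?_
      filter_upwards [self_mem_nhdsWithin] with x hx
      simp only [mem_compl_iff, mem_singleton_iff] at hx ⊢
      exact fun h => hx (ofReal_injective h)
    filter_upwards [ht.eventually (hPcd (c : ℂ))] with x hxP
    have hxP' : conj (x : ℂ) ∉ P := by rwa [conj_ofReal]
    have hqr : ∀ j, conj (qc j (x : ℂ)) = qc j (x : ℂ) := fun j => by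
      have h := hconj j (x : ℂ) hxP hxP'
      rw [conj_ofReal] at h
      exact h.symm
    rw [← Complex.conj_eq_iff_im]
    show conj ((((∫ x in {x : (AdeleRing (𝓞 L) L)ˣ | (IdeleClassGroup.ideleNorm L x : ℝ) ≤ 1} ∩ 𝓕I, (IdeleClassGroup.ideleNorm L x : ℝ) ∂νI) : ℝ) : ℂ) * (((1 : ℝ) : ℂ) * ⟪φK, ∑ j, qc j (x : ℂ) • bK j⟫_ℂ)) = (((∫ x in {x : (AdeleRing (𝓞 L) L)ˣ | (IdeleClassGroup.ideleNorm L x : ℝ) ≤ 1} ∩ 𝓕I, (IdeleClassGroup.ideleNorm L x : ℝ) ∂νI) : ℝ) : ℂ) * (((1 : ℝ) : ℂ) * ⟪φK, ∑ j, qc j (x : ℂ) • bK j⟫_ℂ)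
    rw [hψφ, inner_smul_right, inner_self_eq_norm_sq_to_K]
    simp only [map_mul, _root_.map_sum, Complex.conj_ofReal, RCLike.conj_ofReal, map_pow, hqr]
  -- `hb` in the `|b|`-form of ★ vector-α
  have hb' : ∃ Mb : ℝ, ∀ᶠ z : ℂ in 𝓝[≠] (c : ℂ), ‖z - (c : ℂ)‖ ^ 2 * |(fun z : ℂ => (∫ x in {x : (AdeleRing (𝓞 L) L)ˣ | (IdeleClassGroup.ideleNorm L x : ℝ) ≤ 1} ∩ 𝓕I, (IdeleClassGroup.ideleNorm L x : ℝ) ∂νI) * 1 * ‖(fun z => ∑ j, qc j z • bK j) z‖ ^ 2) z| ≤ Mb := by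
    obtain ⟨Mb, hMb⟩ := hb
    refine ⟨Mb, hMb.mono fun z hz => ?_⟩
    have h0 : 0 ≤ (∫ x in {x : (AdeleRing (𝓞 L) L)ˣ | (IdeleClassGroup.ideleNorm L x : ℝ) ≤ 1} ∩ 𝓕I, (IdeleClassGroup.ideleNorm L x : ℝ) ∂νI) * 1 * ‖(fun z => ∑ j, qc j z • bK j) z‖ ^ 2 := mul_nonneg (mul_nonneg hκ.le zero_le_one) (sq_nonneg _)
    have habs : |(fun z : ℂ => (∫ x in {x : (AdeleRing (𝓞 L) L)ˣ | (IdeleClassGroup.ideleNorm L x : ℝ) ≤ 1} ∩ 𝓕I, (IdeleClassGroup.ideleNorm L x : ℝ) ∂νI) * 1 * ‖(fun z => ∑ j, qc j z • bK j) z‖ ^ 2) z| = (∫ x in {x : (AdeleRing (𝓞 L) L)ˣ | (IdeleClassGroup.ideleNorm L x : ℝ) ≤ 1} ∩ 𝓕I, (IdeleClassGroup.ideleNorm L x : ℝ) ∂νI) * 1 * ‖(fun z => ∑ j, qc j z • bK j) z‖ ^ 2 := abs_of_nonneg h0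
    rw [habs]
    exact hz
  -- (ii) the `L²`-residue (★ p860642)
  obtain ⟨u, hu⟩ := exists_chi_L2Residue_real_pole_cm_two hDUo hDUc hDUsub hO₁o hO₁ne hO₁D hO₂o hO₂ne hO₂D hsep₁ hDLo hDLc hDLsub hO₃o hO₃ne hO₃D hO₄o hO₄ne hO₄D hsep₂
    hT0 (a := (∫ x in {x : (AdeleRing (𝓞 L) L)ˣ | (IdeleClassGroup.ideleNorm L x : ℝ) ≤ 1} ∩ 𝓕I, (IdeleClassGroup.ideleNorm L x : ℝ) ∂νI) * 1 * ‖φK‖ ^ 2) (b := fun z => (∫ x in {x : (AdeleRing (𝓞 L) L)ˣ | (IdeleClassGroup.ideleNorm L x : ℝ) ≤ 1} ∩ 𝓕I, (IdeleClassGroup.ideleNorm L x : ℝ) ∂νI) * 1 * ‖(fun z => ∑ j, qc j z • bK j) z‖ ^ 2) (real_mul_inner_self (∫ x in {x : (AdeleRing (𝓞 L) L)ˣ | (IdeleClassGroup.ideleNorm L x : ℝ) ≤ 1} ∩ 𝓕I, (IdeleClassGroup.ideleNorm L x : ℝ) ∂νI) 1 φK)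
    hB₂U hB₃U hB₃₂U hB₄₁U hB₄₂U hB₄dU hB₂L hB₃L hB₃₂L hB₄₁L hB₄₂L hB₄dL (Fam n) ((hFd n).mono (hsubU n)) ((hFd n).mono hsubL) hrel₁ hrel₂ hc hda hde hrealB hb'
    hVo (hFd n) hmem hup hlo
  -- (iii) positivity (★ p860661) with `r := d c`
  have hr : Tendsto (fun z : ℂ => (z - c) * ((((∫ x in {x : (AdeleRing (𝓞 L) L)ˣ | (IdeleClassGroup.ideleNorm L x : ℝ) ≤ 1} ∩ 𝓕I, (IdeleClassGroup.ideleNorm L x : ℝ) ∂νI) : ℝ) : ℂ) * (((1 : ℝ) : ℂ) * ⟪φK, (fun z => ∑ j, qc j z • bK j) z⟫_ℂ))) (𝓝[≠] (c : ℂ)) (𝓝 (d (c : ℂ))) :=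
    ((hda.continuousAt.tendsto).mono_left nhdsWithin_le_nhds).congr' hde
  have h₁ := fun (z : ℂ) (hz : z ∈ (({z : ℂ | 1 / 2 < z.re ∧ 0 < z.im} ∩ Metric.ball (0 : ℂ) (n + 2) ∩ U n) \ P)) => normSq_eq_fourTerm_upper hDUo hDUc hDUsub hO₁o hO₁ne hO₁D hO₂o hO₂ne hO₂D hsep₁ hT0
    (cμ := cμ n) (K := K n) (a := (∫ x in {x : (AdeleRing (𝓞 L) L)ˣ | (IdeleClassGroup.ideleNorm L x : ℝ) ≤ 1} ∩ 𝓕I, (IdeleClassGroup.ideleNorm L x : ℝ) ∂νI) * 1 * ‖φK‖ ^ 2) (b := fun z => (∫ x in {x : (AdeleRing (𝓞 L) L)ˣ | (IdeleClassGroup.ideleNorm L x : ℝ) ≤ 1} ∩ 𝓕I, (IdeleClassGroup.ideleNorm L x : ℝ) ∂νI) * 1 * ‖(fun z => ∑ j, qc j z • bK j) z‖ ^ 2) (B₁ := (((∫ x in {x : (AdeleRing (𝓞 L) L)ˣ | (IdeleClassGroup.ideleNorm L x : ℝ) ≤ 1} ∩ 𝓕I, (IdeleClassGroup.ideleNorm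 L x : ℝ) ∂νI) : ℝ) : ℂ) * (((1 : ℝ) : ℂ) * ⟪φK, φK⟫_ℂ)) (B₂ := fun z' => (((∫ x in {x : (AdeleRing (𝓞 L) L)ˣ | (IdeleClassGroup.ideleNorm L x : ℝ) ≤ 1} ∩ 𝓕I, (IdeleClassGroup.ideleNorm L x : ℝ) ∂νI) : ℝ) : ℂ) * (((1 : ℝ) : ℂ) * ⟪(fun z => ∑ j, qc j z • bK j) z', φK⟫_ℂ)) (B₃ := fun z => (((∫ x in {x : (AdeleRing (𝓞 L) L)ˣ | (IdeleClassGroup.ideleNorm L x : ℝ) ≤ 1} ∩ 𝓕I, (IdeleClassGroup.ideleNorm L x : ℝ) ∂νI) : ℝ) : ℂ) * (((1 : ℝ) : ℂ) * ⟪φK, (fun z => ∑ j, qc j z • bK j) z⟫_ℂ)) (B₄ := fun z z' => (((∫ x in {x : (AdeleRing (𝓞 L) L)ˣ | (IdeleClassGroup.ideleNorm L x : ℝ) ≤ 1} ∩ 𝓕I, (IdeleClassGroup.ideleNorm L x : ℝ) ∂νI) : ℝ) : ℂ) * (((1 : ℝ) : ℂ) * ⟪(fun z => ∑ j, qc j z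 • bK j) z', (fun z => ∑ j, qc j z • bK j) z⟫_ℂ)) (real_mul_inner_self (∫ x in {x : (AdeleRing (𝓞 L) L)ˣ | (IdeleClassGroup.ideleNorm L x : ℝ) ≤ 1} ∩ 𝓕I, (IdeleClassGroup.ideleNorm L x : ℝ) ∂νI) 1 φK)
    hB₂U hB₃U hB₃₂U hB₄₁U hB₄₂U hB₄dU (Fam n) ((hFd n).mono (hsubU n)) hrel₁ hz
  have h₂ := fun (z : ℂ) (hz : z ∈ (({z : ℂ | 1 / 2 < z.re ∧ z.im < 0} ∩ Metric.ball (0 : ℂ) (n + 2) ∩ U n) \ P)) => normSq_eq_fourTerm_lower hDLo hDLc hDLsub hO₃o hO₃ne hO₃D hO₄o hO₄ne hO₄D hsep₂ hT0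
    (cμ := cμ n) (K := K n) (a := (∫ x in {x : (AdeleRing (𝓞 L) L)ˣ | (IdeleClassGroup.ideleNorm L x : ℝ) ≤ 1} ∩ 𝓕I, (IdeleClassGroup.ideleNorm L x : ℝ) ∂νI) * 1 * ‖φK‖ ^ 2) (b := fun z => (∫ x in {x : (AdeleRing (𝓞 L) L)ˣ | (IdeleClassGroup.ideleNorm L x : ℝ) ≤ 1} ∩ 𝓕I, (IdeleClassGroup.ideleNorm L x : ℝ) ∂νI) * 1 * ‖(fun z => ∑ j, qc j z • bK j) z‖ ^ 2) (B₁ := (((∫ x in {x : (AdeleRing (𝓞 L) L)ˣ | (IdeleClassGroup.ideleNorm L x : ℝ) ≤ 1} ∩ 𝓕I, (IdeleClassGroup.ideleNorm L x : ℝ) ∂νI) : ℝ) : ℂ) * (((1 : ℝ) : ℂ) * ⟪φK, φK⟫_ℂ)) (B₂ := fun z' => (((∫ x in {x : (AdeleRing (𝓞 L) L)ˣ | (IdeleClassGroup.ideleNorm L x : ℝ) ≤ 1} ∩ 𝓕I, (IdeleClassGroup.ideleNorm L x : ℝ) ∂νI) : ℝ) : ℂ) * (((1 : ℝ) : ℂ)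 * ⟪(fun z => ∑ j, qc j z • bK j) z', φK⟫_ℂ)) (B₃ := fun z => (((∫ x in {x : (AdeleRing (𝓞 L) L)ˣ | (IdeleClassGroup.ideleNorm L x : ℝ) ≤ 1} ∩ 𝓕I, (IdeleClassGroup.ideleNorm L x : ℝ) ∂νI) : ℝ) : ℂ) * (((1 : ℝ) : ℂ) * ⟪φK, (fun z => ∑ j, qc j z • bK j) z⟫_ℂ)) (B₄ := fun z z' => (((∫ x in {x : (AdeleRing (𝓞 L) L)ˣ | (IdeleClassGroup.ideleNorm L x : ℝ) ≤ 1} ∩ 𝓕I, (IdeleClassGroup.ideleNorm L x : ℝ) ∂νI) : ℝ) : ℂ) * (((1 : ℝ) : ℂ) * ⟪(fun z => ∑ j, qc j z • bK j) z', (fun z => ∑ j, qc j z • bK j) z⟫_ℂ)) (real_mul_inner_self (∫ x in {x : (AdeleRing (𝓞 L) L)ˣ | (IdeleClassGroup.ideleNorm L x : ℝ) ≤ 1} ∩ 𝓕I, (IdeleClassGroup.ideleNorm L x : ℝ) ∂νI) 1 φK)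
    hB₂L hB₃L hB₃₂L hB₄₁L hB₄₂L hB₄dL (Fam n) ((hFd n).mono hsubL) hrel₂ hz
  have hdiag := eventually_normSq_eq_fourTerm (T := ((T₀ n : ℝ≥0) : ℝ)) (cμ := cμ n) (K := K n) (a := (∫ x in {x : (AdeleRing (𝓞 L) L)ˣ | (IdeleClassGroup.ideleNorm L x : ℝ) ≤ 1} ∩ 𝓕I, (IdeleClassGroup.ideleNorm L x : ℝ) ∂νI) * 1 * ‖φK‖ ^ 2) (b := fun z => (∫ x in {x : (AdeleRing (𝓞 L) L)ˣ | (IdeleClassGroup.ideleNorm L x : ℝ) ≤ 1} ∩ 𝓕I, (IdeleClassGroup.ideleNorm L x : ℝ) ∂νI) * 1 * ‖(fun z => ∑ j, qc j z • bK j) z‖ ^ 2)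
    (B₃ := fun z => (((∫ x in {x : (AdeleRing (𝓞 L) L)ˣ | (IdeleClassGroup.ideleNorm L x : ℝ) ≤ 1} ∩ 𝓕I, (IdeleClassGroup.ideleNorm L x : ℝ) ∂νI) : ℝ) : ℂ) * (((1 : ℝ) : ℂ) * ⟪φK, (fun z => ∑ j, qc j z • bK j) z⟫_ℂ)) (Fam n) h₁ h₂ hup hlo
  have hb0 : ∀ᶠ z : ℂ in 𝓝[≠] (c : ℂ), 0 ≤ (fun z => (∫ x in {x : (AdeleRing (𝓞 L) L)ˣ | (IdeleClassGroup.ideleNorm L x : ℝ) ≤ 1} ∩ 𝓕I, (IdeleClassGroup.ideleNorm L x : ℝ) ∂νI) * 1 * ‖(fun z => ∑ j, qc j z • bK j) z‖ ^ 2) z :=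
    Eventually.of_forall fun z => mul_nonneg (mul_nonneg hκ.le zero_le_one) (sq_nonneg _)
  have hpos : 0 < cμ n * K n := mul_pos (hcμ n) (hK n)
  obtain ⟨him, hnn⟩ := residue_real_nonneg_of_diag (cμ n) (K n) hT0 ((∫ x in {x : (AdeleRing (𝓞 L) L)ˣ | (IdeleClassGroup.ideleNorm L x : ℝ) ≤ 1} ∩ 𝓕I, (IdeleClassGroup.ideleNorm L x : ℝ) ∂νI) * 1 * ‖φK‖ ^ 2) (b := fun z => (∫ x in {x : (AdeleRing (𝓞 L) L)ˣ | (IdeleClassGroup.ideleNorm L x : ℝ) ≤ 1} ∩ 𝓕I, (IdeleClassGroup.ideleNorm L x : ℝ) ∂νI) * 1 * ‖(fun z => ∑ j, qc j z • bK j) z‖ ^ 2) (w := fun z => (((∫ x in {x : (AdeleRing (𝓞 L) L)ˣ | (IdeleClassGroup.ideleNorm L x : ℝ) ≤ 1} ∩ 𝓕I, (IdeleClassGroup.ideleNorm L x : ℝ) ∂νI) : ℝ) : ℂ) * (((1 : ℝ) : ℂ) * ⟪φK, (fun z => ∑ j, qc j z • bK j) z⟫_ℂ)) hc hpos hb0 hrealB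 hr (Fam n) hu hdiag
  have hle := normSq_residue_le_of_diag (cμ n) (K n) hT0 ((∫ x in {x : (AdeleRing (𝓞 L) L)ˣ | (IdeleClassGroup.ideleNorm L x : ℝ) ≤ 1} ∩ 𝓕I, (IdeleClassGroup.ideleNorm L x : ℝ) ∂νI) * 1 * ‖φK‖ ^ 2) (b := fun z => (∫ x in {x : (AdeleRing (𝓞 L) L)ˣ | (IdeleClassGroup.ideleNorm L x : ℝ) ≤ 1} ∩ 𝓕I, (IdeleClassGroup.ideleNorm L x : ℝ) ∂νI) * 1 * ‖(fun z => ∑ j, qc j z • bK j) z‖ ^ 2) (w := fun z => (((∫ x in {x : (AdeleRing (𝓞 L) L)ˣ | (IdeleClassGroup.ideleNorm L x : ℝ) ≤ 1} ∩ 𝓕I, (IdeleClassGroup.ideleNorm L x : ℝ) ∂νI) : ℝ) : ℂ) * (((1 : ℝ) : ℂ) * ⟪φK, (fun z => ∑ j, qc j z • bK j) z⟫_ℂ)) hc hpos.le hb0 hr (Fam n) hu hdiag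
  exact ⟨u, d (c : ℂ), cμ n, K n, hcμ n, hK n, hu, hr, him, hnn, hle⟩

end Summit.HodgeConjecture.HodgeConjecture.Cruxes.H413.K2E1ChiMaassSelbergResidueM1CMTwo

end
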